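import Literature.MathematicalPhysics.QuantumFieldTheory.ConformalBootstrap3D.PointFunctionalTermwise

/-!
# The point-functional certificate schema (architecture B″)

What a real-point certificate `φ = Σ_k w_k ev_{(z_k, z̄_k)}` (nodes in the open square, fundamental
domain `z̄_k ≤ z_k`, a dominating apex node `a`) has to supply for `BoxExcluded Q`
(`boxExcluded_of_pointRules`), with the two ends of the obligation list
`SingleCorrelatorObligations` already reduced to closed-form inequalities between the certificate's
own numbers:

* (O1) identity: `0 < termCornerBound w z z̄ 0 0 0 s_lo s_hi` (`identity_pos_of_cornerBound`;
  `𝒫_{0,0} = 1`, `zMono_zero_zero`);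
* (O5) tail with `Δ⋆ = E₀`: termwise positivity on `[E₀, E_T)` (rule (M), box by box through
  `termwise_nonneg_of_cornerBound`) and the apex inequality at `E_T` (rule (T)) —
  `tail_nonneg_pointFunctional_of_termwise_and_apex`;
* (O2)–(O4), the finitely many light blocks below `E₀`, stay as `BlockPositive` hypotheses (cell
  tables, `SingleCorrelatorObligations.of_table`); their `z`-series TERMS with `Δ + n ≥ E₀` are again
  covered by (M)/(T) through `blockPositive_pointFunctional_of_termwise`.

(For checking rows with rational data — `x^(p/q)` against rational bounds by comparing natural
powers — the tree already has `Literature.NumberTheory.Sieve.BetaSieve.le_rpow_div_of_pow_le` /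
`rpow_div_le_of_pow_le`.)

Everything modulo the typed identification T1 (`IsConformalBlock3D.hasSum_hrZTerm`, proved for
regular `(Δ, ℓ)`), and for POINT functionals only (termwise application is a theorem for them,
`evaluationContinuous_pointFunctional`). Term basis: Hogervorst–Rychkov 2013, §3 eq. (3.6).
[cite: HogervorstRychkov2013, §3 eq. (3.6)]
-/

noncomputable section

namespace Literature.MathematicalPhysics.QuantumFieldTheory.ConformalBootstrap3D

open Finset Set

/-- `𝒫_{0,0} ≡ 1`. [folklore] -/
theorem zMono_zero_zero : zMono 0 0 = fun _ _ => (1 : ℝ) := by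
  funext x y
  simp [zMono, zLegendre]

/-- **(O1) on a box from one number.** `0 < termCornerBound w z z̄ 0 0 0 s_lo s_hi` gives
`φ[F^{s}_{-}[1]] > 0` for every `(s, ·) ∈ Q`, `s ∈ [s_lo, s_hi]`. [folklore] -/
theorem identity_pos_of_cornerBound {N : ℕ} (w z zb : Fin N → ℝ)
    (hz : ∀ k, z k ∈ Ioo (0 : ℝ) 1) (hzb : ∀ k, zb k ∈ Ioo (0 : ℝ) 1)
    {Q : Set (ℝ × ℝ)} {slo shi : ℝ} (hQ : ∀ p ∈ Q, slo ≤ p.1 ∧ p.1 ≤ shi)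
    (h : 0 < termCornerBound w z zb 0 0 0 slo shi) :
    ∀ p ∈ Q, 0 < pointFunctional w z zb (crossF p.1 (-1) (fun _ _ => (1 : ℝ))) := by
  intro p hp
  rw [← zMono_zero_zero]
  exact h.trans_le (termCornerBound_le w z zb hz hzb 0 ⟨le_rfl, le_rfl⟩ ⟨(hQ p hp).1, (hQ p hp).2⟩)

/-- **The point-functional certificate schema.** Nodes in the open square with `z̄_k ≤ z_k`, an apex
`a` with `0 ≤ w_a` dominating every direct node (`z_k z̄_k ≤ qd_k² z_a z̄_a`, `z_k ≤ qd_k z_a`,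
`qd_k ∈ (0,1]`) and every reflected node (`(1-z_k)(1-z̄_k) ≤ qr_k² z_a z̄_a`, `1-z̄_k ≤ qr_k z_a`,
`qr_k ∈ (0,1]`); external dimensions `s ∈ [s_lo, s_hi]` on `Q`. Then
(O1) the identity corner number `> 0`, (O2)–(O4) the light-block hypotheses below `E₀`,
(M) termwise positivity of `Φ(E,j,s)` for `E ∈ [E₀, E_T)`, `j + 1/2 ≤ E`, and (T) the apex inequality
at `E_T` give `BoxExcluded Q`. [folklore] -/
theorem boxExcluded_of_pointRules {N : ℕ} {w z zb : Fin N → ℝ}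
    (hz : ∀ k, z k ∈ Ioo (0 : ℝ) 1) (hzb : ∀ k, zb k ∈ Ioo (0 : ℝ) 1) (hord : ∀ k, zb k ≤ z k)
    (a : Fin N) (ha : 0 ≤ w a) (qd qr : Fin N → ℝ) (hqd : ∀ k, 0 < qd k ∧ qd k ≤ 1)
    (hqr : ∀ k, 0 < qr k ∧ qr k ≤ 1)
    (hdomd : ∀ k, z k * zb k ≤ qd k ^ 2 * (z a * zb a) ∧ z k ≤ qd k * z a)
    (hdomr : ∀ k, (1 - z k) * (1 - zb k) ≤ qr k ^ 2 * (z a * zb a) ∧ 1 - zb k ≤ qr k * z a)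
    {Q : Set (ℝ × ℝ)} {slo shi E₀ ET : ℝ} (hQ : ∀ p ∈ Q, slo ≤ p.1 ∧ p.1 ≤ shi)
    (hI : 0 < termCornerBound w z zb 0 0 0 slo shi)
    (hO2 : ∀ p ∈ Q, BlockPositive (pointFunctional w z zb) p.1 p.2 0)
    (hO3 : ∀ p ∈ Q, ∀ Δ : ℝ, 3 ≤ Δ → Δ < E₀ → BlockPositive (pointFunctional w z zb) p.1 Δ 0)
    (hO4 : ∀ p ∈ Q, ∀ ℓ : ℕ, Even ℓ → ℓ ≠ 0 → ∀ Δ : ℝ, (ℓ : ℝ) + 1 ≤ Δ → Δ < E₀ →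
      BlockPositive (pointFunctional w z zb) p.1 Δ ℓ)
    (hM : ∀ (j : ℕ) (E : ℝ), E₀ ≤ E → E < ET → (j : ℝ) + 1 / 2 ≤ E → ∀ p ∈ Q,
      0 ≤ pointFunctional w z zb (crossF p.1 (-1) (zMono E j)))
    (hB : ∑ k ∈ univ.erase a, |w k| * ((1 - z k) * (1 - zb k)) ^ slo * qd k ^ ET
          + ∑ k, |w k| * (z k * zb k) ^ slo * qr k ^ ET ≤ w a * ((1 - z a) * (1 - zb a)) ^ shi) :
    BoxExcluded Q :=
  SingleCorrelatorObligations.boxExcluded (Δstar := E₀) hz hzb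
    { identity_pos := identity_pos_of_cornerBound w z zb hz hzb hQ hI
      epsilon_nonneg := hO2
      scalar_nonneg := hO3
      spinning_nonneg := hO4
      tail_nonneg := fun p hp ℓ _ Δ hbd hΔ0 =>
        tail_nonneg_pointFunctional_of_termwise_and_apex w z zb hz hzb hord a ha qd qr hqd hqr hdomd
          hdomr hQ hM hB p hp ℓ Δ hbd hΔ0 }

end Literature.MathematicalPhysics.QuantumFieldTheory.ConformalBootstrap3D
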